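import Mathlib
import Summits.ValiantsHypothesis.ValiantsHypothesis.Theorems.RigidityForcesSymmetryRankRigidMinimalReprLaplaceFiveStarLoneTerm

/-!
# ValiantsHypothesis / RigidityForcesSymmetry — crux `LaplaceOptimalFive` (stmt-ValiantsHypothesis-24813), crux idea
`young-shadow` (K1) on the star: **READING A TWO-TERM STAR SPLIT AS A CLOSED TWO-TERM LETTER TENSOR**
(memo `NOTE-p4g16-24813-LemmaK-kernel.md` §2 (L3-i); pattern = ✓ `lone_term_crossSwap` / ✓ `sideSym_starPairSplits_of_lone_term`)

First link of the assembly (L3).  A side-symmetric pair decomposition of `P₅` supported on the star `{pa,pb,pc,pd}`; a split `{p,a}`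
carrying EXACTLY TWO terms `t₁ ≠ t₂`.  Reading the short factors `u t_i` as letter functions `U_i (v p) (v a)` and the long factors
`w t_i` as `W_i (v b) (v c) (v d)`:

* `two_term_exchange` (word currency ⟹ letter currency): `U_i` symmetric, `W_i` fully symmetric, and the 8-term EXCHANGE IDENTITY
  `(C_H)` for `H = U₁⊗W₁ + U₂⊗W₂` — exactly the hypothesis `hC` of ✓ `wedge_minors_poly` / ✓ `lemma_two_prime` — from the
  invariance of the star-symmetrised shadow under `(p a)` (✓ `star_coherence`, conjunct 4);
* `two_term_reading` (decomposition currency): the letter functions exist with these properties and read the shadow,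
  `Z_{pa}(v) = Σ_{t : S t = A₀} u t v · w t v = U₁(v p)(v a)·W₁(v b)(v c)(v d) + U₂(v p)(v a)·W₂(v b)(v c)(v d)`.

No new definitions, no `sorry`.  Honest framing: plumbing for (L3); closes nothing; K1-on-the-star PAPER PASS, not kernel;
`LaplaceOptimalFive` OPEN · CONTESTED 72/120; `VP ≠ VNP` NOT proved.
-/

set_option linter.dupNamespace false

namespace Summit.ValiantsHypothesis.ValiantsHypothesis.Theorems.RigidityForcesSymmetryRankRigidMinimalRepr

namespace LaplaceFiveStar

open Finset LaplaceFiveSectorSplit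

/-- **Two terms, word currency ⟹ letter currency.**  `u_i` read the slots `p, a` symmetrically, `w_i` the slots `b, c, d`
symmetrically (`p,a,b,c,d` distinct); `Z = u₁w₁ + u₂w₂` star-symmetrised is invariant under `(p a)`.  With the letter functions
`U_i x y = u_i(x@p, y@a)`, `W_i x y z = w_i(x@b, y@c, z@d)`: the `U_i` are symmetric, the `W_i` fully symmetric, and the exchange
identity `(C_H)` holds. [folklore] -/
theorem two_term_exchange (p a b c d : Fin 5) (hpa : p ≠ a) (hpb : p ≠ b) (hpc : p ≠ c) (hpd : p ≠ d) (hab : a ≠ b)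
    (hac : a ≠ c) (had : a ≠ d) (hbc : b ≠ c) (hbd : b ≠ d) (hcd : c ≠ d) (u₁ w₁ u₂ w₂ : (Fin 5 → Fin 5) → ℂ)
    (hu₁ : ∀ v v' : Fin 5 → Fin 5, v p = v' p → v a = v' a → u₁ v = u₁ v')
    (hw₁ : ∀ v v' : Fin 5 → Fin 5, v b = v' b → v c = v' c → v d = v' d → w₁ v = w₁ v')
    (hu₂ : ∀ v v' : Fin 5 → Fin 5, v p = v' p → v a = v' a → u₂ v = u₂ v')
    (hw₂ : ∀ v v' : Fin 5 → Fin 5, v b = v' b → v c = v' c → v d = v' d → w₂ v = w₂ v')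
    (hus₁ : ∀ v : Fin 5 → Fin 5, u₁ (v ∘ ⇑(Equiv.swap p a)) = u₁ v)
    (hwbc₁ : ∀ v : Fin 5 → Fin 5, w₁ (v ∘ ⇑(Equiv.swap b c)) = w₁ v)
    (hwcd₁ : ∀ v : Fin 5 → Fin 5, w₁ (v ∘ ⇑(Equiv.swap c d)) = w₁ v)
    (hus₂ : ∀ v : Fin 5 → Fin 5, u₂ (v ∘ ⇑(Equiv.swap p a)) = u₂ v)
    (hwbc₂ : ∀ v : Fin 5 → Fin 5, w₂ (v ∘ ⇑(Equiv.swap b c)) = w₂ v)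
    (hwcd₂ : ∀ v : Fin 5 → Fin 5, w₂ (v ∘ ⇑(Equiv.swap c d)) = w₂ v)
    (hF : ∀ v : Fin 5 → Fin 5,
      (u₁ (v ∘ ⇑(Equiv.swap p a)) * w₁ (v ∘ ⇑(Equiv.swap p a)) + u₂ (v ∘ ⇑(Equiv.swap p a)) * w₂ (v ∘ ⇑(Equiv.swap p a)))
        + (u₁ ((v ∘ ⇑(Equiv.swap p a)) ∘ ⇑(Equiv.swap a b)) * w₁ ((v ∘ ⇑(Equiv.swap p a)) ∘ ⇑(Equiv.swap a b))
          + u₂ ((v ∘ ⇑(Equiv.swap p a)) ∘ ⇑(Equiv.swap a b)) * w₂ ((v ∘ ⇑(Equiv.swap p a)) ∘ ⇑(Equiv.swap a b)))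
        + (u₁ ((v ∘ ⇑(Equiv.swap p a)) ∘ ⇑(Equiv.swap a c)) * w₁ ((v ∘ ⇑(Equiv.swap p a)) ∘ ⇑(Equiv.swap a c))
          + u₂ ((v ∘ ⇑(Equiv.swap p a)) ∘ ⇑(Equiv.swap a c)) * w₂ ((v ∘ ⇑(Equiv.swap p a)) ∘ ⇑(Equiv.swap a c)))
        + (u₁ ((v ∘ ⇑(Equiv.swap p a)) ∘ ⇑(Equiv.swap a d)) * w₁ ((v ∘ ⇑(Equiv.swap p a)) ∘ ⇑(Equiv.swap a d))
          + u₂ ((v ∘ ⇑(Equiv.swap p a)) ∘ ⇑(Equiv.swap a d)) * w₂ ((v ∘ ⇑(Equiv.swap p a)) ∘ ⇑(Equiv.swap a d)))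
      = (u₁ v * w₁ v + u₂ v * w₂ v)
        + (u₁ (v ∘ ⇑(Equiv.swap a b)) * w₁ (v ∘ ⇑(Equiv.swap a b)) + u₂ (v ∘ ⇑(Equiv.swap a b)) * w₂ (v ∘ ⇑(Equiv.swap a b)))
        + (u₁ (v ∘ ⇑(Equiv.swap a c)) * w₁ (v ∘ ⇑(Equiv.swap a c)) + u₂ (v ∘ ⇑(Equiv.swap a c)) * w₂ (v ∘ ⇑(Equiv.swap a c)))
        + (u₁ (v ∘ ⇑(Equiv.swap a d)) * w₁ (v ∘ ⇑(Equiv.swap a d)) + u₂ (v ∘ ⇑(Equiv.swap a d)) * w₂ (v ∘ ⇑(Equiv.swap a d))))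
    (U₁ U₂ : Fin 5 → Fin 5 → ℂ) (W₁ W₂ : Fin 5 → Fin 5 → Fin 5 → ℂ)
    (hU₁ : U₁ = fun x y => u₁ (fun i => if i = p then x else if i = a then y else x))
    (hU₂ : U₂ = fun x y => u₂ (fun i => if i = p then x else if i = a then y else x))
    (hW₁ : W₁ = fun x y z => w₁ (fun i => if i = b then x else if i = c then y else if i = d then z else x))
    (hW₂ : W₂ = fun x y z => w₂ (fun i => if i = b then x else if i = c then y else if i = d then z else x)) :
    (∀ v : Fin 5 → Fin 5, u₁ v = U₁ (v p) (v a)) ∧ (∀ v : Fin 5 → Fin 5, w₁ v = W₁ (v b) (v c) (v d)) ∧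
    (∀ v : Fin 5 → Fin 5, u₂ v = U₂ (v p) (v a)) ∧ (∀ v : Fin 5 → Fin 5, w₂ v = W₂ (v b) (v c) (v d)) ∧
    (∀ x y : Fin 5, U₁ x y = U₁ y x) ∧ (∀ x y : Fin 5, U₂ x y = U₂ y x) ∧
    (∀ x y z : Fin 5, W₁ x y z = W₁ y x z) ∧ (∀ x y z : Fin 5, W₁ x y z = W₁ x z y) ∧
    (∀ x y z : Fin 5, W₂ x y z = W₂ y x z) ∧ (∀ x y z : Fin 5, W₂ x y z = W₂ x z y) ∧
    (∀ A B C D E : Fin 5,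
      (U₁ A C * W₁ B D E + U₁ A D * W₁ B C E + U₁ A E * W₁ B C D)
        + (U₂ A C * W₂ B D E + U₂ A D * W₂ B C E + U₂ A E * W₂ B C D)
      = (U₁ B C * W₁ A D E + U₁ B D * W₁ A C E + U₁ B E * W₁ A C D)
        + (U₂ B C * W₂ A D E + U₂ B D * W₂ A C E + U₂ B E * W₂ A C D)) := by
  have hap : a ≠ p := Ne.symm hpa
  have hcb : c ≠ b := Ne.symm hbc
  have hdb : d ≠ b := Ne.symm hbd
  have hdc : d ≠ c := Ne.symm hcd
  -- reading lemmas
  have F1 : ∀ v : Fin 5 → Fin 5, u₁ v = U₁ (v p) (v a) := fun v => by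
    rw [hU₁]; exact hu₁ v _ (by simp) (by simp [hap])
  have F2 : ∀ v : Fin 5 → Fin 5, w₁ v = W₁ (v b) (v c) (v d) := fun v => by
    rw [hW₁]; exact hw₁ v _ (by simp) (by simp [hcb]) (by simp [hdb, hdc])
  have F3 : ∀ v : Fin 5 → Fin 5, u₂ v = U₂ (v p) (v a) := fun v => by
    rw [hU₂]; exact hu₂ v _ (by simp) (by simp [hap])
  have F4 : ∀ v : Fin 5 → Fin 5, w₂ v = W₂ (v b) (v c) (v d) := fun v => by
    rw [hW₂]; exact hw₂ v _ (by simp) (by simp [hcb]) (by simp [hdb, hdc])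
  -- symmetries of the letter functions
  have symU : ∀ (u : (Fin 5 → Fin 5) → ℂ) (U : Fin 5 → Fin 5 → ℂ),
      (∀ v v' : Fin 5 → Fin 5, v p = v' p → v a = v' a → u v = u v') →
      (∀ v : Fin 5 → Fin 5, u (v ∘ ⇑(Equiv.swap p a)) = u v) →
      U = (fun x y => u (fun i => if i = p then x else if i = a then y else x)) → ∀ x y, U x y = U y x := by
    intro u U hu hus hU x y
    rw [hU]
    have h1 : u (fun i => if i = p then y else if i = a then x else y)
        = u ((fun i => if i = p then x else if i = a then y else x) ∘ ⇑(Equiv.swap p a)) := by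
      refine hu _ _ ?_ ?_
      · simp [Function.comp_apply, hpa.symm]
      · simp [Function.comp_apply, hpa.symm]
    show u _ = u _
    rw [h1, hus]
  have symW1 : ∀ (w : (Fin 5 → Fin 5) → ℂ) (W : Fin 5 → Fin 5 → Fin 5 → ℂ),
      (∀ v v' : Fin 5 → Fin 5, v b = v' b → v c = v' c → v d = v' d → w v = w v') →
      (∀ v : Fin 5 → Fin 5, w (v ∘ ⇑(Equiv.swap b c)) = w v) →
      W = (fun x y z => w (fun i => if i = b then x else if i = c then y else if i = d then z else x)) →
      ∀ x y z, W x y z = W y x z := by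
    intro w W hw hwbc hW x y z
    rw [hW]
    have h1 : w (fun i => if i = b then y else if i = c then x else if i = d then z else y)
        = w ((fun i => if i = b then x else if i = c then y else if i = d then z else x) ∘ ⇑(Equiv.swap b c)) := by
      refine hw _ _ ?_ ?_ ?_
      · simp [Function.comp_apply, hbc.symm]
      · simp [Function.comp_apply, hbc.symm]
      · simp [Function.comp_apply, Equiv.swap_apply_def, hbd.symm, hcd.symm]
    show w _ = w _
    rw [h1, hwbc]
  have symW2 : ∀ (w : (Fin 5 → Fin 5) → ℂ) (W : Fin 5 → Fin 5 → Fin 5 → ℂ),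
      (∀ v v' : Fin 5 → Fin 5, v b = v' b → v c = v' c → v d = v' d → w v = w v') →
      (∀ v : Fin 5 → Fin 5, w (v ∘ ⇑(Equiv.swap c d)) = w v) →
      W = (fun x y z => w (fun i => if i = b then x else if i = c then y else if i = d then z else x)) →
      ∀ x y z, W x y z = W x z y := by
    intro w W hw hwcd hW x y z
    rw [hW]
    have h1 : w (fun i => if i = b then x else if i = c then z else if i = d then y else x)
        = w ((fun i => if i = b then x else if i = c then y else if i = d then z else x) ∘ ⇑(Equiv.swap c d)) := by
      refine hw _ _ ?_ ?_ ?_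
      · simp [Function.comp_apply, Equiv.swap_apply_def, hbc, hbd]
      · simp [Function.comp_apply, hbc.symm, hbd.symm, hcd.symm]
      · simp [Function.comp_apply, hbc.symm, hbd.symm, hcd.symm]
    show w _ = w _
    rw [h1, hwcd]
  have hU1s := symU u₁ U₁ hu₁ hus₁ hU₁
  have hU2s := symU u₂ U₂ hu₂ hus₂ hU₂
  have hW1a := symW1 w₁ W₁ hw₁ hwbc₁ hW₁
  have hW1b := symW2 w₁ W₁ hw₁ hwcd₁ hW₁
  have hW2a := symW1 w₂ W₂ hw₂ hwbc₂ hW₂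
  have hW2b := symW2 w₂ W₂ hw₂ hwcd₂ hW₂
  refine ⟨F1, F2, F3, F4, hU1s, hU2s, hW1a, hW1b, hW2a, hW2b, ?_⟩
  -- the exchange identity from `hF` at the word with letters `A, B, C, D, E` in the slots `p, a, b, c, d`
  intro A B C D E
  set ω : Fin 5 → Fin 5 := fun i => if i = p then A else if i = a then B else if i = b then C else if i = c then D else E
    with hωdef
  have h := hF ω
  simp only [F1, F2, F3, F4, Function.comp_apply, Equiv.swap_apply_def] at h
  simp only [hωdef, hpa, hpb, hpc, hpd, hab, hac, had, hbc, hbd, hcd, hpa.symm, hpb.symm, hpc.symm, hpd.symm, hab.symm,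
    hac.symm, had.symm, hbc.symm, hbd.symm, hcd.symm, if_true, if_false] at h
  have e1 : W₁ C B E = W₁ B C E := hW1a C B E
  have e2 : W₁ C D B = W₁ B C D := by rw [hW1b C D B, hW1a C B D]
  have e3 : W₁ C A E = W₁ A C E := hW1a C A E
  have e4 : W₁ C D A = W₁ A C D := by rw [hW1b C D A, hW1a C A D]
  have e5 : U₁ B A = U₁ A B := hU1s B A
  have f1 : W₂ C B E = W₂ B C E := hW2a C B E
  have f2 : W₂ C D B = W₂ B C D := by rw [hW2b C D B, hW2a C B D]
  have f3 : W₂ C A E = W₂ A C E := hW2a C A E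
  have f4 : W₂ C D A = W₂ A C D := by rw [hW2b C D A, hW2a C A D]
  have f5 : U₂ B A = U₂ A B := hU2s B A
  linear_combination (-1 : ℂ) * h + W₁ C D E * e5 + U₁ B D * e3 + U₁ B E * e4 - U₁ A D * e1 - U₁ A E * e2
    + W₂ C D E * f5 + U₂ B D * f3 + U₂ B E * f4 - U₂ A D * f1 - U₂ A E * f2

variable {N : ℕ}

/-- **Two-term reading (decomposition currency).**  In a side-symmetric pair decomposition of `P₅` supported on a star, a split `A₀`
carrying exactly two terms `t₁ ≠ t₂` is read by letter tensors `U₁, U₂` (symmetric) and `W₁, W₂` (fully symmetric) satisfying the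
exchange identity `(C_H)` — the hypotheses of ✓ `lemma_two_prime` (given independence of `U₁, U₂`). [folklore] -/
theorem two_term_reading (T : Finset (Fin N)) (S : Fin N → Finset (Fin 5))
    (u w : Fin N → (Fin 5 → Fin 5) → ℂ) (hdec : IsSplitDecomposition T S u w) (hsym : SideSymmetric T S u w)
    (hpair : ∀ t ∈ T, (S t).card = 2) (h4 : (T.image S).card = 4) (hstar : ∃ c : Fin 5, ∀ A ∈ T.image S, c ∈ A)
    (A₀ : Finset (Fin 5)) (hA₀ : A₀ ∈ T.image S) (htwo : (T.filter (fun t => S t = A₀)).card = 2) :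
    ∃ p a b c d : Fin 5, p ≠ a ∧ p ≠ b ∧ p ≠ c ∧ p ≠ d ∧ a ≠ b ∧ a ≠ c ∧ a ≠ d ∧ b ≠ c ∧ b ≠ d ∧ c ≠ d ∧
      A₀ = {p, a} ∧ T.image S = {({p, a} : Finset (Fin 5)), {p, b}, {p, c}, {p, d}} ∧
    ∃ t₁ t₂ : Fin N, t₁ ≠ t₂ ∧ T.filter (fun t => S t = A₀) = {t₁, t₂} ∧
    ∃ (U₁ U₂ : Fin 5 → Fin 5 → ℂ) (W₁ W₂ : Fin 5 → Fin 5 → Fin 5 → ℂ),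
      (∀ v : Fin 5 → Fin 5, (∑ t ∈ T.filter (fun t => S t = A₀), u t v * w t v)
        = U₁ (v p) (v a) * W₁ (v b) (v c) (v d) + U₂ (v p) (v a) * W₂ (v b) (v c) (v d)) ∧
      (∀ v : Fin 5 → Fin 5, u t₁ v = U₁ (v p) (v a)) ∧ (∀ v : Fin 5 → Fin 5, w t₁ v = W₁ (v b) (v c) (v d)) ∧
      (∀ v : Fin 5 → Fin 5, u t₂ v = U₂ (v p) (v a)) ∧ (∀ v : Fin 5 → Fin 5, w t₂ v = W₂ (v b) (v c) (v d)) ∧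
      (∀ x y : Fin 5, U₁ x y = U₁ y x) ∧ (∀ x y : Fin 5, U₂ x y = U₂ y x) ∧
      (∀ x y z : Fin 5, W₁ x y z = W₁ y x z) ∧ (∀ x y z : Fin 5, W₁ x y z = W₁ x z y) ∧
      (∀ x y z : Fin 5, W₂ x y z = W₂ y x z) ∧ (∀ x y z : Fin 5, W₂ x y z = W₂ x z y) ∧
      (∀ A B C D E : Fin 5,
        (U₁ A C * W₁ B D E + U₁ A D * W₁ B C E + U₁ A E * W₁ B C D)
          + (U₂ A C * W₂ B D E + U₂ A D * W₂ B C E + U₂ A E * W₂ B C D)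
        = (U₁ B C * W₁ A D E + U₁ B D * W₁ A C E + U₁ B E * W₁ A C D)
          + (U₂ B C * W₂ A D E + U₂ B D * W₂ A C E + U₂ B E * W₂ A C D)) := by
  classical
  obtain ⟨hu, hw, hid⟩ := hdec
  obtain ⟨p, hp⟩ := hstar
  -- the two terms
  obtain ⟨t₁, t₂, ht12, ht⟩ := Finset.card_eq_two.mp htwo
  have ht₁T : t₁ ∈ T ∧ S t₁ = A₀ := by
    have : t₁ ∈ T.filter (fun t => S t = A₀) := by rw [ht]; simp
    exact Finset.mem_filter.mp this
  have ht₂T : t₂ ∈ T ∧ S t₂ = A₀ := by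
    have : t₂ ∈ T.filter (fun t => S t = A₀) := by rw [ht]; simp
    exact Finset.mem_filter.mp this
  -- `A₀ = {p, a}`
  have hpairI : ∀ A ∈ T.image S, A.card = 2 := fun A hA => by
    obtain ⟨t, ht', rfl⟩ := Finset.mem_image.mp hA; exact hpair t ht'
  have hleaf : ∀ A ∈ T.image S, ∃ x : Fin 5, p ≠ x ∧ A = {p, x} := by
    intro A hA
    obtain ⟨x, y, hxy, hxy'⟩ := Finset.card_eq_two.mp (hpairI A hA)
    have hcm := hp A hA
    rw [hxy'] at hcm
    simp only [Finset.mem_insert, Finset.mem_singleton] at hcm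
    rcases hcm with rfl | rfl
    · exact ⟨y, hxy, hxy'⟩
    · exact ⟨x, fun h => hxy (h ▸ rfl), by rw [hxy', Finset.pair_comm]⟩
  obtain ⟨a, hpa, hA₀e⟩ := hleaf A₀ hA₀
  -- the other three leaves
  have h3 : ((T.image S).erase A₀).card = 3 := by rw [Finset.card_erase_of_mem hA₀, h4]
  obtain ⟨B₁, B₂, B₃, h12, h13, h23, hE⟩ := Finset.card_eq_three.mp h3
  have hB : ∀ B, B ∈ (T.image S).erase A₀ → ∃ x : Fin 5, p ≠ x ∧ x ≠ a ∧ B = {p, x} := by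
    intro B hBm
    have hBI : B ∈ T.image S := Finset.mem_of_mem_erase hBm
    have hBne : B ≠ A₀ := Finset.ne_of_mem_erase hBm
    obtain ⟨x, hpx, hBe⟩ := hleaf B hBI
    refine ⟨x, hpx, fun h => hBne ?_, hBe⟩
    rw [hBe, hA₀e, h]
  have m1 : B₁ ∈ (T.image S).erase A₀ := by rw [hE]; simp
  have m2 : B₂ ∈ (T.image S).erase A₀ := by rw [hE]; simp
  have m3 : B₃ ∈ (T.image S).erase A₀ := by rw [hE]; simp
  obtain ⟨b, hpb, hba, hB₁e⟩ := hB B₁ m1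
  obtain ⟨c, hpc, hca, hB₂e⟩ := hB B₂ m2
  obtain ⟨d, hpd, hda, hB₃e⟩ := hB B₃ m3
  have hbc : b ≠ c := fun h => h12 (by rw [hB₁e, hB₂e, h])
  have hbd : b ≠ d := fun h => h13 (by rw [hB₁e, hB₃e, h])
  have hcd : c ≠ d := fun h => h23 (by rw [hB₂e, hB₃e, h])
  have hab : a ≠ b := Ne.symm hba
  have hac : a ≠ c := Ne.symm hca
  have had : a ≠ d := Ne.symm hda
  -- the five slots exhaust `Fin 5`
  have hcover : ∀ i : Fin 5, i = p ∨ i = a ∨ i = b ∨ i = c ∨ i = d := by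
    have hc5 : ({p, a, b, c, d} : Finset (Fin 5)).card = 5 := by
      rw [Finset.card_insert_of_notMem, Finset.card_insert_of_notMem, Finset.card_insert_of_notMem,
        Finset.card_pair hcd]
      · simp [hbc, hbd]
      · simp [hab, hac, had]
      · simp [hpa, hpb, hpc, hpd]
    have huniv := Finset.eq_univ_of_card _ (by rw [hc5]; simp)
    intro i
    have hi : i ∈ ({p, a, b, c, d} : Finset (Fin 5)) := by rw [huniv]; exact Finset.mem_univ i
    simpa using hi
  have himage : T.image S = {({p, a} : Finset (Fin 5)), {p, b}, {p, c}, {p, d}} := by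
    rw [← Finset.insert_erase hA₀, hE, hA₀e, hB₁e, hB₂e, hB₃e]
  -- shadows
  set Z : Finset (Fin 5) → (Fin 5 → Fin 5) → ℂ := fun A v => ∑ t ∈ T.filter (fun t => S t = A), u t v * w t v with hZ
  have hside : ∀ A ∈ T.image S, SlotInvariantOn A (Z A) ∧ SlotInvariantOn Aᶜ (Z A) := fun A _ =>
    ⟨fun τ hτ v => LaplaceFiveTriangleSeparation.shadow_inv_left T S u w hw hsym A τ hτ v,
      fun τ hτ v => LaplaceFiveTriangleSeparation.shadow_inv_right T S u w hu hsym A τ hτ v⟩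
  have hfib : ∀ v : Fin 5 → Fin 5, ∑ A ∈ T.image S, Z A v = if Function.Injective v then 1 else 0 := by
    intro v
    simp only [hZ]
    rw [Finset.sum_fiberwise_of_maps_to (g := S) (fun t (ht : t ∈ T) => Finset.mem_image_of_mem S ht)]
    exact hid v
  have hsum4 : SlotInvariantOn Finset.univ (Z A₀ + Z B₁ + Z B₂ + Z B₃) := by
    have e : Z A₀ + Z B₁ + Z B₂ + Z B₃ = fun v => ∑ A ∈ T.image S, Z A v := by
      funext v
      rw [(Finset.insert_erase hA₀).symm, Finset.sum_insert (Finset.notMem_erase A₀ _), hE,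
        Finset.sum_insert (by simp [h12, h13]), Finset.sum_insert (by simp [h23]), Finset.sum_singleton]
      simp only [Pi.add_apply]
      ring
    rw [e]
    intro τ _ v
    show (∑ A ∈ T.image S, Z A (v ∘ ⇑τ)) = ∑ A ∈ T.image S, Z A v
    rw [hfib, hfib, if_congr (Equiv.injective_comp τ v) rfl rfl]
  have hZ₀ : SlotInvariantOn A₀ (Z A₀) ∧ SlotInvariantOn A₀ᶜ (Z A₀) := hside A₀ hA₀
  have coh := star_coherence p a b c d hpa hpb hpc hpd hab hac had hbc hbd hcd (Z A₀) (Z B₁) (Z B₂) (Z B₃)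
    (by rw [← hA₀e]; exact hZ₀) (by rw [← hB₁e]; exact hside B₁ (Finset.mem_of_mem_erase m1))
    (by rw [← hB₂e]; exact hside B₂ (Finset.mem_of_mem_erase m2))
    (by rw [← hB₃e]; exact hside B₃ (Finset.mem_of_mem_erase m3)) hsum4
  have hsymm4 := coh.2.2.2
  -- the shadow is a sum of two products
  have hZ₀eq : ∀ v, Z A₀ v = u t₁ v * w t₁ v + u t₂ v * w t₂ v := fun v => by
    show (∑ t ∈ T.filter (fun t => S t = A₀), u t v * w t v) = u t₁ v * w t₁ v + u t₂ v * w t₂ v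
    rw [ht, Finset.sum_pair ht12]
  -- word-currency hypotheses for both terms
  have hS₁ : S t₁ = {p, a} := ht₁T.2.trans hA₀e
  have hS₂ : S t₂ = {p, a} := ht₂T.2.trans hA₀e
  have hu' : ∀ t, S t = {p, a} → ∀ v v' : Fin 5 → Fin 5, v p = v' p → v a = v' a → u t v = u t v' :=
    fun t hSt v v' h1 h2 => hu t v v' fun i hi => by
      rw [hSt] at hi
      simp only [Finset.mem_insert, Finset.mem_singleton] at hi
      rcases hi with rfl | rfl
      · exact h1
      · exact h2
  have hw' : ∀ t, S t = {p, a} → ∀ v v' : Fin 5 → Fin 5, v b = v' b → v c = v' c → v d = v' d → w t v = w t v' :=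
    fun t hSt v v' h1 h2 h3 => hw t v v' fun i hi => by
      rw [hSt] at hi
      simp only [Finset.mem_insert, Finset.mem_singleton, not_or] at hi
      rcases hcover i with h | h | h | h | h
      · exact absurd h hi.1
      · exact absurd h hi.2
      · rw [h]; exact h1
      · rw [h]; exact h2
      · rw [h]; exact h3
  have hus : ∀ t, t ∈ T → S t = {p, a} → ∀ v : Fin 5 → Fin 5, u t (v ∘ ⇑(Equiv.swap p a)) = u t v :=
    fun t htT hSt v => invUnder_swap_of_mem (A := S t) (hsym t htT).1 (by rw [hSt]; simp) (by rw [hSt]; simp) v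
  have hwbc : ∀ t, t ∈ T → S t = {p, a} → ∀ v : Fin 5 → Fin 5, w t (v ∘ ⇑(Equiv.swap b c)) = w t v :=
    fun t htT hSt v => invUnder_swap_of_not_mem (A := S t) (hsym t htT).2 (by rw [hSt]; simp [Ne.symm hpb, Ne.symm hab])
      (by rw [hSt]; simp [Ne.symm hpc, Ne.symm hac]) v
  have hwcd : ∀ t, t ∈ T → S t = {p, a} → ∀ v : Fin 5 → Fin 5, w t (v ∘ ⇑(Equiv.swap c d)) = w t v :=
    fun t htT hSt v => invUnder_swap_of_not_mem (A := S t) (hsym t htT).2 (by rw [hSt]; simp [Ne.symm hpc, Ne.symm hac])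
      (by rw [hSt]; simp [Ne.symm hpd, Ne.symm had]) v
  have hF : ∀ v : Fin 5 → Fin 5,
      (u t₁ (v ∘ ⇑(Equiv.swap p a)) * w t₁ (v ∘ ⇑(Equiv.swap p a)) + u t₂ (v ∘ ⇑(Equiv.swap p a)) * w t₂ (v ∘ ⇑(Equiv.swap p a)))
        + (u t₁ ((v ∘ ⇑(Equiv.swap p a)) ∘ ⇑(Equiv.swap a b)) * w t₁ ((v ∘ ⇑(Equiv.swap p a)) ∘ ⇑(Equiv.swap a b))
          + u t₂ ((v ∘ ⇑(Equiv.swap p a)) ∘ ⇑(Equiv.swap a b)) * w t₂ ((v ∘ ⇑(Equiv.swap p a)) ∘ ⇑(Equiv.swap a b)))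
        + (u t₁ ((v ∘ ⇑(Equiv.swap p a)) ∘ ⇑(Equiv.swap a c)) * w t₁ ((v ∘ ⇑(Equiv.swap p a)) ∘ ⇑(Equiv.swap a c))
          + u t₂ ((v ∘ ⇑(Equiv.swap p a)) ∘ ⇑(Equiv.swap a c)) * w t₂ ((v ∘ ⇑(Equiv.swap p a)) ∘ ⇑(Equiv.swap a c)))
        + (u t₁ ((v ∘ ⇑(Equiv.swap p a)) ∘ ⇑(Equiv.swap a d)) * w t₁ ((v ∘ ⇑(Equiv.swap p a)) ∘ ⇑(Equiv.swap a d))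
          + u t₂ ((v ∘ ⇑(Equiv.swap p a)) ∘ ⇑(Equiv.swap a d)) * w t₂ ((v ∘ ⇑(Equiv.swap p a)) ∘ ⇑(Equiv.swap a d)))
      = (u t₁ v * w t₁ v + u t₂ v * w t₂ v)
        + (u t₁ (v ∘ ⇑(Equiv.swap a b)) * w t₁ (v ∘ ⇑(Equiv.swap a b)) + u t₂ (v ∘ ⇑(Equiv.swap a b)) * w t₂ (v ∘ ⇑(Equiv.swap a b)))
        + (u t₁ (v ∘ ⇑(Equiv.swap a c)) * w t₁ (v ∘ ⇑(Equiv.swap a c)) + u t₂ (v ∘ ⇑(Equiv.swap a c)) * w t₂ (v ∘ ⇑(Equiv.swap a c)))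
        + (u t₁ (v ∘ ⇑(Equiv.swap a d)) * w t₁ (v ∘ ⇑(Equiv.swap a d)) + u t₂ (v ∘ ⇑(Equiv.swap a d)) * w t₂ (v ∘ ⇑(Equiv.swap a d))) := by
    intro v
    have h := hsymm4 (Equiv.swap p a) (fun i hi => absurd (Finset.mem_univ i) hi) v
    simp only [Pi.add_apply, hZ₀eq] at h
    exact h
  set U₁ : Fin 5 → Fin 5 → ℂ := fun x y => u t₁ (fun i => if i = p then x else if i = a then y else x) with hU₁def
  set U₂ : Fin 5 → Fin 5 → ℂ := fun x y => u t₂ (fun i => if i = p then x else if i = a then y else x) with hU₂def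
  set W₁ : Fin 5 → Fin 5 → Fin 5 → ℂ :=
    fun x y z => w t₁ (fun i => if i = b then x else if i = c then y else if i = d then z else x) with hW₁def
  set W₂ : Fin 5 → Fin 5 → Fin 5 → ℂ :=
    fun x y z => w t₂ (fun i => if i = b then x else if i = c then y else if i = d then z else x) with hW₂def
  have hex := two_term_exchange p a b c d hpa hpb hpc hpd hab hac had hbc hbd hcd (u t₁) (w t₁) (u t₂) (w t₂)
    (hu' t₁ hS₁) (hw' t₁ hS₁) (hu' t₂ hS₂) (hw' t₂ hS₂) (hus t₁ ht₁T.1 hS₁) (hwbc t₁ ht₁T.1 hS₁) (hwcd t₁ ht₁T.1 hS₁)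
    (hus t₂ ht₂T.1 hS₂) (hwbc t₂ ht₂T.1 hS₂) (hwcd t₂ ht₂T.1 hS₂) hF U₁ U₂ W₁ W₂ hU₁def hU₂def hW₁def hW₂def
  have hshadow : ∀ v : Fin 5 → Fin 5, (∑ t ∈ T.filter (fun t => S t = A₀), u t v * w t v)
      = U₁ (v p) (v a) * W₁ (v b) (v c) (v d) + U₂ (v p) (v a) * W₂ (v b) (v c) (v d) := fun v => by
    rw [← hex.1 v, ← hex.2.1 v, ← hex.2.2.1 v, ← hex.2.2.2.1 v]
    exact hZ₀eq v
  exact ⟨p, a, b, c, d, hpa, hpb, hpc, hpd, hab, hac, had, hbc, hbd, hcd, hA₀e, himage, t₁, t₂, ht12, ht, U₁, U₂, W₁, W₂,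
    hshadow, hex⟩

end LaplaceFiveStar

end Summit.ValiantsHypothesis.ValiantsHypothesis.Theorems.RigidityForcesSymmetryRankRigidMinimalRepr
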